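import Summits.BirchSwinnertonDyer.BirchSwinnertonDyer.Theorems.Rank2ObservatoryRank2Table
import Summits.BirchSwinnertonDyer.BirchSwinnertonDyer.Theorems.Rank2ObservatoryRank2Rows90a
import Summits.BirchSwinnertonDyer.BirchSwinnertonDyer.Theorems.Rank2ObservatoryRank2Rows90b
import Summits.BirchSwinnertonDyer.BirchSwinnertonDyer.Theorems.Rank2ObservatoryRank2Rows91a
import Summits.BirchSwinnertonDyer.BirchSwinnertonDyer.Theorems.Rank2ObservatoryRank2Rows91b
import Summits.BirchSwinnertonDyer.BirchSwinnertonDyer.Theorems.Rank2ObservatoryRank2Rows92a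
import Summits.BirchSwinnertonDyer.BirchSwinnertonDyer.Theorems.Rank2ObservatoryRank2Rows92b
import Summits.BirchSwinnertonDyer.BirchSwinnertonDyer.Theorems.Rank2ObservatoryRank2Rows93a
import Summits.BirchSwinnertonDyer.BirchSwinnertonDyer.Theorems.Rank2ObservatoryRank2Rows93b
import Summits.BirchSwinnertonDyer.BirchSwinnertonDyer.Theorems.Rank2ObservatoryRank2Rows94a
import Summits.BirchSwinnertonDyer.BirchSwinnertonDyer.Theorems.Rank2ObservatoryRank2Rows94b
import Summits.BirchSwinnertonDyer.BirchSwinnertonDyer.Theorems.Rank2ObservatoryRank2Rows95a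
import Summits.BirchSwinnertonDyer.BirchSwinnertonDyer.Theorems.Rank2ObservatoryRank2Rows95b
import Summits.BirchSwinnertonDyer.BirchSwinnertonDyer.Theorems.Rank2ObservatoryRank2Rows96a
import Summits.BirchSwinnertonDyer.BirchSwinnertonDyer.Theorems.Rank2ObservatoryRank2Rows96b
import Summits.BirchSwinnertonDyer.BirchSwinnertonDyer.Theorems.Rank2ObservatoryRank2Rows97a
import Summits.BirchSwinnertonDyer.BirchSwinnertonDyer.Theorems.Rank2ObservatoryRank2Rows97b
import Summits.BirchSwinnertonDyer.BirchSwinnertonDyer.Theorems.Rank2ObservatoryRank2Rows98a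
import Summits.BirchSwinnertonDyer.BirchSwinnertonDyer.Theorems.Rank2ObservatoryRank2Rows98b
import Summits.BirchSwinnertonDyer.BirchSwinnertonDyer.Theorems.Rank2ObservatoryRank2Rows99a
import Summits.BirchSwinnertonDyer.BirchSwinnertonDyer.Theorems.Rank2ObservatoryRank2Rows99b
import HarnessLib

/-!
# BirchSwinnertonDyer — rank ≥ 2 observatory: rank-2 census table, decade 9 of 10 (`450000 ≤ N < 500000`)

HONEST FRAMING: per-curve certified theorems and census instruments; no claim on BSD in rank ≥ 2.

Machine-written AGGREGATION level of the rank-2 census (schema `Rank2ObservatoryRank2Table.lean`, data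
chunks `Rank2ObservatoryRank2Rows90a … 99b`, census `Rank2ObservatoryRank2Census.lean`): `rank2Decade9` is the
concatenation of the 20 chunks of conductor windows 90–99 (`450000 ≤ N < 500000`; a window above the gate's
200 kB file cap is stored as two half-window chunks `NNa`, `NNb`) — rows 311447–348672 of `rank2_table.tsv`
(sha256 `8b151c933b69ee8dae4834c21efd171353ae94c887716c05b7381d12d173f912`), 37226 curves from `450018g1` to
`499998e1`. Its theorems are assembled from the chunk theorems (each a kernel `decide`) by
`List.all_append` / `List.length_append` rewriting only; no row is re-evaluated here. The two-level
assembly (chunks → decades → table) keeps every file under the tree's 400-line limit and every list short.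

Reference: J. E. Cremona, *Algorithms for Modular Elliptic Curves* (2nd ed. 1997), tables / ecdata.
-/

-- single-conjunct summit: `Summit.BirchSwinnertonDyer.BirchSwinnertonDyer.…` repeats the name by design
set_option linter.dupNamespace false

namespace Summit.BirchSwinnertonDyer.BirchSwinnertonDyer.Rank2Observatory

/-- The 20 chunks of decade 9 (conductors `450000 ≤ N < 500000`), in order. [cite: CremonaAlgorithms1997, Tables] -/
noncomputable def rank2Decade9Chunks : List (List Rank2Row) := [
  rank2Rows90a, rank2Rows90b, rank2Rows91a, rank2Rows91b, rank2Rows92a, rank2Rows92b,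
  rank2Rows93a, rank2Rows93b, rank2Rows94a, rank2Rows94b, rank2Rows95a, rank2Rows95b,
  rank2Rows96a, rank2Rows96b, rank2Rows97a, rank2Rows97b, rank2Rows98a, rank2Rows98b,
  rank2Rows99a, rank2Rows99b]

/-- Decade 9 of the rank-2 census table: the 37226 rank-2 curves of conductor `450000 ≤ N < 500000` (rows 311447–348672).
[cite: CremonaAlgorithms1997, Tables] -/
noncomputable def rank2Decade9 : List Rank2Row :=
  rank2Decade9Chunks.flatten

/-- Every row of decade 9 satisfies `Rank2Row.check` (from the 20 chunk theorems). [folklore] -/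
theorem rank2Decade9_check : rank2Decade9.all Rank2Row.check = true := by
  simp only [rank2Decade9, rank2Decade9Chunks, List.flatten_cons, List.flatten_nil, List.all_append, List.all_nil,
    Bool.and_true,
    rank2Rows90a_check, rank2Rows90b_check, rank2Rows91a_check, rank2Rows91b_check,
    rank2Rows92a_check, rank2Rows92b_check, rank2Rows93a_check, rank2Rows93b_check,
    rank2Rows94a_check, rank2Rows94b_check, rank2Rows95a_check, rank2Rows95b_check,
    rank2Rows96a_check, rank2Rows96b_check, rank2Rows97a_check, rank2Rows97b_check,
    rank2Rows98a_check, rank2Rows98b_check, rank2Rows99a_check, rank2Rows99b_check]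

/-- Decade 9 has `37226` rows (sum of the 20 kernel-counted chunk lengths). [cite: CremonaAlgorithms1997, Tables] -/
theorem rank2Decade9_length : rank2Decade9.length = 37226 := by
  simp only [rank2Decade9, rank2Decade9Chunks, List.flatten_cons, List.flatten_nil, List.length_append, List.length_nil,
    rank2Rows90a_length, rank2Rows90b_length, rank2Rows91a_length, rank2Rows91b_length,
    rank2Rows92a_length, rank2Rows92b_length, rank2Rows93a_length, rank2Rows93b_length,
    rank2Rows94a_length, rank2Rows94b_length, rank2Rows95a_length, rank2Rows95b_length,
    rank2Rows96a_length, rank2Rows96b_length, rank2Rows97a_length, rank2Rows97b_length,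
    rank2Rows98a_length, rank2Rows98b_length, rank2Rows99a_length, rank2Rows99b_length]

/-- Every conductor of decade 9 is `< 500 000` (from the 20 kernel-checked chunk ranges).
[cite: CremonaAlgorithms1997, Tables] -/
theorem rank2Decade9_conductor_lt : rank2Decade9.all (fun r => decide (r.N < 500000)) = true := by
  simp only [rank2Decade9, rank2Decade9Chunks, List.flatten_cons, List.flatten_nil, List.all_append, List.all_nil,
    Bool.and_true,
    Rank2Row.all_conductorLt_of_all_range (by norm_num) rank2Rows90a_conductor,
    Rank2Row.all_conductorLt_of_all_range (by norm_num) rank2Rows90b_conductor,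
    Rank2Row.all_conductorLt_of_all_range (by norm_num) rank2Rows91a_conductor,
    Rank2Row.all_conductorLt_of_all_range (by norm_num) rank2Rows91b_conductor,
    Rank2Row.all_conductorLt_of_all_range (by norm_num) rank2Rows92a_conductor,
    Rank2Row.all_conductorLt_of_all_range (by norm_num) rank2Rows92b_conductor,
    Rank2Row.all_conductorLt_of_all_range (by norm_num) rank2Rows93a_conductor,
    Rank2Row.all_conductorLt_of_all_range (by norm_num) rank2Rows93b_conductor,
    Rank2Row.all_conductorLt_of_all_range (by norm_num) rank2Rows94a_conductor,
    Rank2Row.all_conductorLt_of_all_range (by norm_num) rank2Rows94b_conductor,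
    Rank2Row.all_conductorLt_of_all_range (by norm_num) rank2Rows95a_conductor,
    Rank2Row.all_conductorLt_of_all_range (by norm_num) rank2Rows95b_conductor,
    Rank2Row.all_conductorLt_of_all_range (by norm_num) rank2Rows96a_conductor,
    Rank2Row.all_conductorLt_of_all_range (by norm_num) rank2Rows96b_conductor,
    Rank2Row.all_conductorLt_of_all_range (by norm_num) rank2Rows97a_conductor,
    Rank2Row.all_conductorLt_of_all_range (by norm_num) rank2Rows97b_conductor,
    Rank2Row.all_conductorLt_of_all_range (by norm_num) rank2Rows98a_conductor,
    Rank2Row.all_conductorLt_of_all_range (by norm_num) rank2Rows98b_conductor,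
    Rank2Row.all_conductorLt_of_all_range (by norm_num) rank2Rows99a_conductor,
    Rank2Row.all_conductorLt_of_all_range (by norm_num) rank2Rows99b_conductor]

/-- A row of a chunk of decade 9 is a row of the decade. [folklore] -/
theorem mem_rank2Decade9_of_mem_chunk {l : List Rank2Row} (hl : l ∈ rank2Decade9Chunks) {r : Rank2Row} (hr : r ∈ l) :
    r ∈ rank2Decade9 :=
  List.mem_flatten.mpr ⟨l, hl, hr⟩

/-- Chunk 90a is a chunk of decade 9. [folklore] -/
theorem rank2Rows90a_mem_decade9 : rank2Rows90a ∈ rank2Decade9Chunks :=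
  List.mem_iff_getElem?.mpr ⟨0, rfl⟩

/-- Chunk 90b is a chunk of decade 9. [folklore] -/
theorem rank2Rows90b_mem_decade9 : rank2Rows90b ∈ rank2Decade9Chunks :=
  List.mem_iff_getElem?.mpr ⟨1, rfl⟩

/-- Chunk 91a is a chunk of decade 9. [folklore] -/
theorem rank2Rows91a_mem_decade9 : rank2Rows91a ∈ rank2Decade9Chunks :=
  List.mem_iff_getElem?.mpr ⟨2, rfl⟩

/-- Chunk 91b is a chunk of decade 9. [folklore] -/
theorem rank2Rows91b_mem_decade9 : rank2Rows91b ∈ rank2Decade9Chunks :=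
  List.mem_iff_getElem?.mpr ⟨3, rfl⟩

/-- Chunk 92a is a chunk of decade 9. [folklore] -/
theorem rank2Rows92a_mem_decade9 : rank2Rows92a ∈ rank2Decade9Chunks :=
  List.mem_iff_getElem?.mpr ⟨4, rfl⟩

/-- Chunk 92b is a chunk of decade 9. [folklore] -/
theorem rank2Rows92b_mem_decade9 : rank2Rows92b ∈ rank2Decade9Chunks :=
  List.mem_iff_getElem?.mpr ⟨5, rfl⟩

/-- Chunk 93a is a chunk of decade 9. [folklore] -/
theorem rank2Rows93a_mem_decade9 : rank2Rows93a ∈ rank2Decade9Chunks :=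
  List.mem_iff_getElem?.mpr ⟨6, rfl⟩

/-- Chunk 93b is a chunk of decade 9. [folklore] -/
theorem rank2Rows93b_mem_decade9 : rank2Rows93b ∈ rank2Decade9Chunks :=
  List.mem_iff_getElem?.mpr ⟨7, rfl⟩

/-- Chunk 94a is a chunk of decade 9. [folklore] -/
theorem rank2Rows94a_mem_decade9 : rank2Rows94a ∈ rank2Decade9Chunks :=
  List.mem_iff_getElem?.mpr ⟨8, rfl⟩

/-- Chunk 94b is a chunk of decade 9. [folklore] -/
theorem rank2Rows94b_mem_decade9 : rank2Rows94b ∈ rank2Decade9Chunks :=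
  List.mem_iff_getElem?.mpr ⟨9, rfl⟩

/-- Chunk 95a is a chunk of decade 9. [folklore] -/
theorem rank2Rows95a_mem_decade9 : rank2Rows95a ∈ rank2Decade9Chunks :=
  List.mem_iff_getElem?.mpr ⟨10, rfl⟩

/-- Chunk 95b is a chunk of decade 9. [folklore] -/
theorem rank2Rows95b_mem_decade9 : rank2Rows95b ∈ rank2Decade9Chunks :=
  List.mem_iff_getElem?.mpr ⟨11, rfl⟩

/-- Chunk 96a is a chunk of decade 9. [folklore] -/
theorem rank2Rows96a_mem_decade9 : rank2Rows96a ∈ rank2Decade9Chunks :=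
  List.mem_iff_getElem?.mpr ⟨12, rfl⟩

/-- Chunk 96b is a chunk of decade 9. [folklore] -/
theorem rank2Rows96b_mem_decade9 : rank2Rows96b ∈ rank2Decade9Chunks :=
  List.mem_iff_getElem?.mpr ⟨13, rfl⟩

/-- Chunk 97a is a chunk of decade 9. [folklore] -/
theorem rank2Rows97a_mem_decade9 : rank2Rows97a ∈ rank2Decade9Chunks :=
  List.mem_iff_getElem?.mpr ⟨14, rfl⟩

/-- Chunk 97b is a chunk of decade 9. [folklore] -/
theorem rank2Rows97b_mem_decade9 : rank2Rows97b ∈ rank2Decade9Chunks :=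
  List.mem_iff_getElem?.mpr ⟨15, rfl⟩

/-- Chunk 98a is a chunk of decade 9. [folklore] -/
theorem rank2Rows98a_mem_decade9 : rank2Rows98a ∈ rank2Decade9Chunks :=
  List.mem_iff_getElem?.mpr ⟨16, rfl⟩

/-- Chunk 98b is a chunk of decade 9. [folklore] -/
theorem rank2Rows98b_mem_decade9 : rank2Rows98b ∈ rank2Decade9Chunks :=
  List.mem_iff_getElem?.mpr ⟨17, rfl⟩

/-- Chunk 99a is a chunk of decade 9. [folklore] -/
theorem rank2Rows99a_mem_decade9 : rank2Rows99a ∈ rank2Decade9Chunks :=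
  List.mem_iff_getElem?.mpr ⟨18, rfl⟩

/-- Chunk 99b is a chunk of decade 9. [folklore] -/
theorem rank2Rows99b_mem_decade9 : rank2Rows99b ∈ rank2Decade9Chunks :=
  List.mem_iff_getElem?.mpr ⟨19, rfl⟩

end Summit.BirchSwinnertonDyer.BirchSwinnertonDyer.Rank2Observatory
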